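import Summits.FinalStateConjecture.FinalStateConjecture.Theorems.EIHFluxBalanceEIHFluxEvaluationKSAlgebra
import Literature.Geometry.Lorentzian.LandauLifshitzSuperpotentialVariation

/-!
# Route EIHFluxBalance — `EIHFluxEvaluation` (c): the Landau–Lifshitz complex of a Kerr–Schild
# family is LINEAR in the mass parameter

Helper file (`--supports stmt-FinalStateConjecture-10188`, clause (c) of the informal item
`EIHFluxEvaluation`). For a **Kerr–Schild family** `g_s = η + s K` on an open set `V ⊆ E4` — `K` of
class `C^∞` on `V` with null rank-one values `K(y) = φ(y) ℓ_y ⊗ ℓ_y`, `ℓ_y` `η`-null (Kerr–Schild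
1965, §1; for boosted Kerr `s` is the mass `M`) — the Landau–Lifshitz superpotential is affine in
`s` pointwise (`KSFlux.superpotential_ksFamily`): `H(g_s)(y) = H(η) + s · DH(η)(K(y))` with `DH(η)`
the derivative of the VALUE map `A ↦ H^{μβνα}(A)` at the flat values
(`Literature.…LandauLifshitz.fderiv_superpotential_const_apply`; `superpotential_ksFamily_eq`).
Hence its coordinate derivatives are LINEAR in `s` (chain rule through the fixed continuous linear
functional `DH(η)`):

* `h^{μνα}(g_s)(x) = s · (16π)⁻¹ Σ_β DH^{μβνα}(η)(∂_β K(x))` (`hField_ksFamily`, LL (96.2));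
* `Σ_α ∂_α h^{μνα}(g_s)(x) = s · (16π)⁻¹ Σ_{αβ} DH^{μβνα}(η)(∂_α∂_β K(x))` (`emComplex_ksFamily`,
  LL (96.5)): the energy–momentum complex `(−g)(T^{μν} + t^{μν}_LL)` of the family is `s` times ONE
  fixed field, linear in the second derivatives of `K`; in particular
  `emComplex(g_s) = s · emComplex(g_1)` (`emComplex_ksFamily_eq_mul`).

This is the formal content of "the quadratic (pseudotensorial) part of the Landau–Lifshitz complex
drops out in Kerr–Schild coordinates" (Gürses–Gürsey, J. Math. Phys. 16 (1975) 2385, §IV); the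
vanishing of the remaining linear part in vacuum is the companion file `…KSVacuum`.
-/

noncomputable section

open Filter Set
open scoped Matrix Topology ContDiff

namespace Summit.FinalStateConjecture.FinalStateConjecture.Theorems

namespace KSFlux

open Literature.Geometry.Lorentzian Literature.Geometry.Lorentzian.LandauLifshitz
set_option maxSynthPendingDepth 3

variable {K : E4 → E4 →L[ℝ] E4 →L[ℝ] ℝ}

/-! ### The value-derivative `DH(η)` of the superpotential at the flat values -/

/-- **`DH^{μβνα}(η)(X)` in components**: the derivative of the value map `A ↦ H^{μβνα}(A)` at
`A = η` in the direction `X` is the `X`-linear expression of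
`Literature.…LandauLifshitz.principalPart_cancel` at `U = diag(−1,1,1,1)`, `d = −1`, evaluated on
the components `(X_{ρσ})` (Jacobi's formula and `D(A⁻¹) = −A⁻¹XA⁻¹` at `η`).
[cite: LandauLifshitz1975, §96 (96.3)] -/
theorem fderiv_superpotential_minkowski_apply (X : E4 →L[ℝ] E4 →L[ℝ] ℝ) (μ β ν α : Fin 4) :
    (fderiv ℝ (fun A : E4 →L[ℝ] E4 →L[ℝ] ℝ ↦ superpotential (fun _ : E4 ↦ A) 0 μ β ν α)
        Minkowski.bilin) X = (-((-1 : ℝ) * Matrix.trace ((Matrix.diagonal ![(-1 : ℝ), 1, 1, 1]) *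
        (gram (fun _ : E4 ↦ X) 0))) * ((Matrix.diagonal ![(-1 : ℝ), 1, 1, 1]) μ ν *
        (Matrix.diagonal ![(-1 : ℝ), 1, 1, 1]) β α - (Matrix.diagonal ![(-1 : ℝ), 1, 1, 1]) β ν *
        (Matrix.diagonal ![(-1 : ℝ), 1, 1, 1]) μ α) + (-1 : ℝ) * (((Matrix.diagonal ![(-1 : ℝ), 1,
        1, 1]) * (gram (fun _ : E4 ↦ X) 0) * (Matrix.diagonal ![(-1 : ℝ), 1, 1, 1])) μ ν *
        (Matrix.diagonal ![(-1 : ℝ), 1, 1, 1]) β α + (Matrix.diagonal ![(-1 : ℝ), 1, 1, 1]) μ ν *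
        ((Matrix.diagonal ![(-1 : ℝ), 1, 1, 1]) * (gram (fun _ : E4 ↦ X) 0) * (Matrix.diagonal
        ![(-1 : ℝ), 1, 1, 1])) β α - ((Matrix.diagonal ![(-1 : ℝ), 1, 1, 1]) * (gram (fun _ : E4 ↦
        X) 0) * (Matrix.diagonal ![(-1 : ℝ), 1, 1, 1])) β ν * (Matrix.diagonal ![(-1 : ℝ), 1, 1,
        1]) μ α - (Matrix.diagonal ![(-1 : ℝ), 1, 1, 1]) β ν * ((Matrix.diagonal ![(-1 : ℝ), 1, 1,
        1]) * (gram (fun _ : E4 ↦ X) 0) * (Matrix.diagonal ![(-1 : ℝ), 1, 1, 1])) μ α)) := by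
  have h0 : metricDet (fun _ : E4 ↦ Minkowski.bilin) 0 ≠ 0 := by
    rw [metricDet_minkowski]; norm_num
  rw [fderiv_superpotential_const_apply h0 X μ β ν α, upper_minkowski, metricDet_minkowski,
    ← diag_signs_eq]

/-- **The superpotential of a Kerr–Schild family through `DH(η)`**: at a null rank-one point,
`H^{μβνα}(g_s)(y) = H^{μβνα}(η) + s · DH^{μβνα}(η)(K(y))` for EVERY real `s`
(`superpotential_ksFamily` read through `fderiv_superpotential_minkowski_apply`).
[cite: KerrSchild1965, §1] -/
theorem superpotential_ksFamily_eq {y : E4} {φ : ℝ} {ℓ : E4 →L[ℝ] ℝ} {n : E4}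
    (hn : ∀ w, Minkowski.bilin n w = ℓ w) (hℓ : ℓ n = 0) (hK : K y = φ • E4.tmul ℓ ℓ) (s : ℝ)
    (μ β ν α : Fin 4) :
    superpotential (fun z ↦ Minkowski.bilin + s • K z) y μ β ν α =
      superpotential (fun _ : E4 ↦ Minkowski.bilin) 0 μ β ν α + s * (fderiv ℝ (fun A : E4 →L[ℝ] E4
          →L[ℝ] ℝ ↦ superpotential (fun _ : E4 ↦ A) 0 μ β ν α) Minkowski.bilin) (K y) := by
  rw [superpotential_ksFamily hn hℓ hK s μ β ν α, fderiv_superpotential_minkowski_apply]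
  rfl

/-! ### Calculus of `C^∞` maps on an open set -/

section Smooth

variable {V : Set E4} {x : E4}

/-- A `C^∞` map on the open set `V` is differentiable at its points. [folklore] -/
theorem differentiableAt_of_contDiffOn {F : Type*} [NormedAddCommGroup F] [NormedSpace ℝ F]
    {f : E4 → F} (hV : IsOpen V) (hf : ContDiffOn ℝ ∞ f V) (hx : x ∈ V) :
    DifferentiableAt ℝ f x :=
  ((hf x hx).contDiffAt (hV.mem_nhds hx)).differentiableAt (by simp)

/-- The derivative of a `C^∞` map on the open set `V` is `C^∞` on `V`. [folklore] -/
theorem contDiffOn_fderiv_of_contDiffOn {F : Type*} [NormedAddCommGroup F] [NormedSpace ℝ F]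
    {f : E4 → F} (hV : IsOpen V) (hf : ContDiffOn ℝ ∞ f V) :
    ContDiffOn ℝ ∞ (fderiv ℝ f) V :=
  hf.fderiv_of_isOpen hV (by simp)

/-- The derivative of a `C^∞` map on the open set `V` is differentiable at its points.
[folklore] -/
theorem differentiableAt_fderiv_of_contDiffOn {F : Type*} [NormedAddCommGroup F]
    [NormedSpace ℝ F] {f : E4 → F} (hV : IsOpen V) (hf : ContDiffOn ℝ ∞ f V) (hx : x ∈ V) :
    DifferentiableAt ℝ (fderiv ℝ f) x :=
  differentiableAt_of_contDiffOn hV (contDiffOn_fderiv_of_contDiffOn hV hf) hx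

/-- Chain rule through a fixed continuous linear functional: `∂_v (L ∘ f)(x) = L(Df(x) v)`.
[folklore] -/
theorem fderiv_clm_comp_apply {F : Type*} [NormedAddCommGroup F] [NormedSpace ℝ F]
    {f : E4 → F} (L : F →L[ℝ] ℝ) (hf : DifferentiableAt ℝ f x) (v : E4) :
    fderiv ℝ (fun y ↦ L (f y)) x v = L (fderiv ℝ f x v) := by
  have h : HasFDerivAt (fun y ↦ L (f y)) (L.comp (fderiv ℝ f x)) x :=
    L.hasFDerivAt.comp x hf.hasFDerivAt
  rw [h.fderiv, ContinuousLinearMap.comp_apply]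

/-- Differentiability of `L ∘ f` for a fixed continuous linear functional `L`. [folklore] -/
theorem differentiableAt_clm_comp {F : Type*} [NormedAddCommGroup F] [NormedSpace ℝ F]
    {f : E4 → F} (L : F →L[ℝ] ℝ) (hf : DifferentiableAt ℝ f x) :
    DifferentiableAt ℝ (fun y ↦ L (f y)) x :=
  (L.hasFDerivAt.comp x hf.hasFDerivAt).differentiableAt

end Smooth

/-! ### `h^{μνα}` and the complex of the family are linear in `s` -/

section Family

variable {V : Set E4} {x : E4}

/-- **`h^{μνα}` of a Kerr–Schild family is linear in the parameter** (LL (96.2) applied to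
`H(g_s) = H(η) + s DH(η)(K)`): at a point of the open set `V` on which `K` is `C^∞` with null
rank-one values, `h^{μνα}(g_s)(x) = s (16π)⁻¹ Σ_β DH^{μβνα}(η)(DK(x) ∂_β)`.
[cite: LandauLifshitz1975, §96 (96.2)] -/
theorem hField_ksFamily (hV : IsOpen V) (hK : ContDiffOn ℝ ∞ K V)
    (hKS : ∀ y ∈ V, ∃ φ : ℝ, ∃ ℓ : E4 →L[ℝ] ℝ, ∃ n : E4,
      (∀ w, Minkowski.bilin n w = ℓ w) ∧ ℓ n = 0 ∧ K y = φ • E4.tmul ℓ ℓ)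
    (hx : x ∈ V) (s : ℝ) (μ ν α : Fin 4) :
    hField (fun z ↦ Minkowski.bilin + s • K z) x μ ν α =
      s * ((16 * Real.pi)⁻¹ * ∑ β : Fin 4,
        (fderiv ℝ (fun A : E4 →L[ℝ] E4 →L[ℝ] ℝ ↦ superpotential (fun _ : E4 ↦ A) 0 μ β ν α)
            Minkowski.bilin) (fderiv ℝ K x (E4.basisVector β))) := by
  have hd : DifferentiableAt ℝ K x := differentiableAt_of_contDiffOn hV hK hx
  have key : ∀ β : Fin 4,
      partialDeriv β (fun y ↦ superpotential (fun z ↦ Minkowski.bilin + s • K z) y μ β ν α) x =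
        s * (fderiv ℝ (fun A : E4 →L[ℝ] E4 →L[ℝ] ℝ ↦ superpotential (fun _ : E4 ↦ A) 0 μ β ν α)
            Minkowski.bilin) (fderiv ℝ K x (E4.basisVector β)) := by
    intro β
    have heq : (fun y ↦ superpotential (fun z ↦ Minkowski.bilin + s • K z) y μ β ν α) =ᶠ[𝓝 x]
        fun y ↦ superpotential (fun _ : E4 ↦ Minkowski.bilin) 0 μ β ν α +
          s * (fderiv ℝ (fun A : E4 →L[ℝ] E4 →L[ℝ] ℝ ↦ superpotential (fun _ : E4 ↦ A) 0 μ β ν α)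
              Minkowski.bilin) (K y) :=
      Filter.eventually_of_mem (hV.mem_nhds hx) fun y hy ↦ by
        obtain ⟨φ, ℓ, n, hn, hℓ, hKy⟩ := hKS y hy
        exact superpotential_ksFamily_eq hn hℓ hKy s μ β ν α
    rw [partialDeriv_apply, heq.fderiv_eq, fderiv_const_add,
      fderiv_const_mul (differentiableAt_clm_comp _ hd), FunLike.coe_smul, Pi.smul_apply,
      smul_eq_mul, fderiv_clm_comp_apply _ hd]
  unfold hField
  simp only [key]
  rw [← Finset.mul_sum]
  ring

/-- **The Landau–Lifshitz complex of a Kerr–Schild family is linear in the parameter**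
(LL (96.5) `Σ_α ∂_α h^{μνα} = (−g)(T^{μν} + t^{μν})` applied to `h(g_s) = s h₁`):
`Σ_α ∂_α h^{μνα}(g_s)(x) = s (16π)⁻¹ Σ_{αβ} DH^{μβνα}(η)(D²K(x)(∂_α, ∂_β))`.
[cite: LandauLifshitz1975, §96 (96.5)] -/
theorem emComplex_ksFamily (hV : IsOpen V) (hK : ContDiffOn ℝ ∞ K V)
    (hKS : ∀ y ∈ V, ∃ φ : ℝ, ∃ ℓ : E4 →L[ℝ] ℝ, ∃ n : E4,
      (∀ w, Minkowski.bilin n w = ℓ w) ∧ ℓ n = 0 ∧ K y = φ • E4.tmul ℓ ℓ)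
    (hx : x ∈ V) (s : ℝ) (μ ν : Fin 4) :
    emComplex (fun z ↦ Minkowski.bilin + s • K z) x μ ν =
      s * ((16 * Real.pi)⁻¹ * ∑ α : Fin 4, ∑ β : Fin 4,
        (fderiv ℝ (fun A : E4 →L[ℝ] E4 →L[ℝ] ℝ ↦ superpotential (fun _ : E4 ↦ A) 0 μ β ν α)
            Minkowski.bilin) (fderiv ℝ (fderiv ℝ K) x (E4.basisVector α) (E4.basisVector β))) := by
  have hD : DifferentiableAt ℝ (fderiv ℝ K) x := differentiableAt_fderiv_of_contDiffOn hV hK hx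
  have hDβ : ∀ β : Fin 4, DifferentiableAt ℝ (fun y ↦ fderiv ℝ K y (E4.basisVector β)) x :=
    fun β ↦ MetricCoord.differentiableAt_clm_apply_const hD _
  have key : ∀ α : Fin 4,
      partialDeriv α (fun y ↦ hField (fun z ↦ Minkowski.bilin + s • K z) y μ ν α) x =
        s * ((16 * Real.pi)⁻¹ * ∑ β : Fin 4,
          (fderiv ℝ (fun A : E4 →L[ℝ] E4 →L[ℝ] ℝ ↦ superpotential (fun _ : E4 ↦ A) 0 μ β ν α)
              Minkowski.bilin) (fderiv ℝ (fderiv ℝ K) x (E4.basisVector α) (E4.basisVector β))) :=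
              by
    intro α
    have heq : (fun y ↦ hField (fun z ↦ Minkowski.bilin + s • K z) y μ ν α) =ᶠ[𝓝 x]
        fun y ↦ s * ((16 * Real.pi)⁻¹ * ∑ β : Fin 4,
          (fderiv ℝ (fun A : E4 →L[ℝ] E4 →L[ℝ] ℝ ↦ superpotential (fun _ : E4 ↦ A) 0 μ β ν α)
              Minkowski.bilin) (fderiv ℝ K y (E4.basisVector β))) :=
      Filter.eventually_of_mem (hV.mem_nhds hx) fun y hy ↦ hField_ksFamily hV hK hKS hy s μ ν α
    have hsum : DifferentiableAt ℝ (fun y ↦ ∑ β : Fin 4,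
        (fderiv ℝ (fun A : E4 →L[ℝ] E4 →L[ℝ] ℝ ↦ superpotential (fun _ : E4 ↦ A) 0 μ β ν α)
            Minkowski.bilin) (fderiv ℝ K y (E4.basisVector β))) x :=
      DifferentiableAt.fun_sum fun β _ ↦ differentiableAt_clm_comp _ (hDβ β)
    rw [partialDeriv_apply, heq.fderiv_eq, fderiv_const_mul (hsum.const_mul _),
      fderiv_const_mul hsum, fderiv_fun_sum fun β _ ↦ differentiableAt_clm_comp _ (hDβ β)]
    simp only [FunLike.coe_smul, Pi.smul_apply, smul_eq_mul, _root_.sum_apply]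
    congr 2
    refine Finset.sum_congr rfl fun β _ ↦ ?_
    rw [fderiv_clm_comp_apply _ (hDβ β), MetricCoord.fderiv_clm_apply_const hD]
  unfold emComplex
  simp only [key]
  rw [← Finset.mul_sum, ← Finset.mul_sum]

/-- **The complex scales with the mass parameter**: `emComplex(g_s)(x) = s · emComplex(g_1)(x)`
on `V`. [cite: LandauLifshitz1975, §96 (96.5)] -/
theorem emComplex_ksFamily_eq_mul (hV : IsOpen V) (hK : ContDiffOn ℝ ∞ K V)
    (hKS : ∀ y ∈ V, ∃ φ : ℝ, ∃ ℓ : E4 →L[ℝ] ℝ, ∃ n : E4,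
      (∀ w, Minkowski.bilin n w = ℓ w) ∧ ℓ n = 0 ∧ K y = φ • E4.tmul ℓ ℓ)
    (hx : x ∈ V) (s : ℝ) (μ ν : Fin 4) :
    emComplex (fun z ↦ Minkowski.bilin + s • K z) x μ ν =
      s * emComplex (fun z ↦ Minkowski.bilin + (1 : ℝ) • K z) x μ ν := by
  rw [emComplex_ksFamily hV hK hKS hx s, emComplex_ksFamily hV hK hKS hx 1, one_mul]

end Family

end KSFlux

end Summit.FinalStateConjecture.FinalStateConjecture.Theorems

end
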